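import Literature.Computability.AlgebraicComplexity.DeterminantalComplexityProofs
import Literature.LinearAlgebra.Matrix.PermanentLaplace
import Summits.ValiantsHypothesis.ValiantsHypothesis.Theorems.DetQPDetqpThesisStubDcPerPolyLeDcHyperdet
import Summits.ValiantsHypothesis.ValiantsHypothesis.Theorems.DetqpThesis.Negative.Variants

/-!
# `DetqpThesis` (stmt-ValiantsHypothesis-0315), line `chow-rank-ladder` — stub S5:
# the top pin `dc (per_r) ≤ dc (P n r)` of the rank ladder

The rank-`r` permanent is `P n r := per_n (U Vᵀ)`, the generic permanent `perPoly (Fin n) ℂ`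
with `x_{ij}` replaced by `Σ_a U_{ia} V_{ja}`, `U_{ia} = X (inl (i, a))`, `V_{ja} = X (inr (j, a))`.

`stub_perLeRankPer`: for `r ≤ n`, `dc (per_r) ≤ dc (P n r)`.

Proof.  `r = 0`: `dc (per_0) = 0` (`dcPer_zero`).  For `r = s + 1 ≤ n = s + 1 + t` substitute
variables and constants (a Valiant projection): `U = [Y; e_s; …; e_s]` (`Y` the generic
`(s+1) × (s+1)` matrix, then `t` rows `e_s`) and `V_j = e_{min (j, s)}`.  Then `(U Vᵀ)_{ij}` is
`Y_{i, min (j, s)}` for `i ≤ s` and `[s ≤ j]` for `i > s`: the columns `j ≥ s` all coincide.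
Expanding the permanent along the last row (`Matrix.permanent_eq_sum_row`), the `t + 2` nonzero
terms (columns `j ≥ s`) all have the SAME minor, namely the matrix of one size less
(`submatrix_succAbove_eq_of_colConst`), whence `per = (t+1)! · per Y` by induction on `t`
(`permanent_eq_factorial_mul_of_colConst`).  So `(t+1)! · per_{s+1}` is a projection of
`P n (s+1)` (`isProjection_C_mul_perPoly_rankPer`), `dc` is monotone under projections
(`determinantalComplexity_le_of_isProjection_holds`), and the unit `(t+1)!` is absorbed into one
row of a representation of positive size (`determinantalComplexity_perPoly_le_C_mul_of_ne_zero`,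
as in `determinantalComplexity_perPoly_le_C_mul`).

Sources: folklore; P. Bürgisser, *Completeness and Reduction in Algebraic Complexity Theory*
(2000), §2.5 (projections and `dc`); H. Minc, *Permanents* (1978), §1.2 (Laplace expansion);
T. Mignon, N. Ressayre (2004), §1 (affine determinantal representations).
-/

-- single-conjunct layout: Sub = Summit, duplicated namespace component intended
set_option linter.dupNamespace false

noncomputable section

namespace Summit.ValiantsHypothesis.ValiantsHypothesis.Theorems.DetQPDetqpThesis.ChowRankPerLeRankPer

open MvPolynomial
open Literature.Computability.AlgebraicComplexity

/-! ### §1 The permanent of a matrix whose columns `≥ s` coincide and whose rows `> s` are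
`[s ≤ j]` -/

section Permanent

variable {R : Type*}

/-- Deleting the last row and a column `j ≥ s` from the `(N+1) × (N+1)` matrix `(E i j)` whose
columns `≥ s` coincide gives the `N × N` matrix `(E i j)`. [folklore] -/
theorem submatrix_succAbove_eq_of_colConst (s N : ℕ) (E : ℕ → ℕ → R)
    (hcol : ∀ a b, s ≤ b → E a b = E a s) (j : Fin (N + 1)) (hj : s ≤ j.val) :
    (Matrix.of fun i j : Fin (N + 1) => E i.val j.val).submatrix Fin.castSucc j.succAbove =
      Matrix.of fun i j : Fin N => E i.val j.val := by
  ext i c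
  simp only [Matrix.submatrix_apply, Matrix.of_apply, Fin.val_castSucc]
  by_cases h : c.castSucc < j
  · rw [Fin.succAbove_of_castSucc_lt _ _ h, Fin.val_castSucc]
  · rw [Fin.succAbove_of_le_castSucc _ _ (not_lt.mp h), Fin.val_succ]
    have hc : s ≤ c.val := by
      have h' := Fin.le_def.mp (not_lt.mp h)
      rw [Fin.val_castSucc] at h'
      omega
    rw [hcol _ _ (by omega), hcol _ _ hc]

/-- `∑_{b < N} [s ≤ b] c = (N - s) • c`. [folklore] -/
theorem sum_range_ite_le_const {M : Type*} [AddCommMonoid M] (s : ℕ) (c : M) :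
    ∀ N : ℕ, (∑ b ∈ Finset.range N, if s ≤ b then c else 0) = (N - s) • c
  | 0 => by simp
  | N + 1 => by
    rw [Finset.sum_range_succ, sum_range_ite_le_const s c N]
    split_ifs with h
    · rw [show N + 1 - s = (N - s) + 1 by omega, succ_nsmul]
    · rw [show N + 1 - s = 0 by omega, show N - s = 0 by omega, add_zero]

/-- **The permanent identity.** Let `E i j` (`i, j ∈ ℕ`) satisfy: the columns `j ≥ s`
coincide, and the rows `i > s` are the indicator `[s ≤ j]`.  Then the permanent of the
`(s+1+t) × (s+1+t)` matrix `(E i j)` is `(t+1)!` times that of its top-left `(s+1) × (s+1)`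
block: expand along the last row (Minc 1978, §1.2; `Matrix.permanent_eq_sum_row`), whose `t + 2`
nonzero entries `1` (columns `j ≥ s`) all have the same minor, the matrix of one size less.
[folklore] -/
theorem permanent_eq_factorial_mul_of_colConst [CommRing R] (s : ℕ) (E : ℕ → ℕ → R)
    (hcol : ∀ a b, s ≤ b → E a b = E a s)
    (hrow : ∀ a b, s + 1 ≤ a → E a b = if s ≤ b then 1 else 0) (t : ℕ) :
    (Matrix.of fun i j : Fin (s + 1 + t) => E i.val j.val).permanent =
      ((t + 1).factorial : R) * (Matrix.of fun i j : Fin (s + 1) => E i.val j.val).permanent := by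
  induction t with
  | zero => simp
  | succ t ih =>
    show (Matrix.of fun i j : Fin (s + 1 + t + 1) => E i.val j.val).permanent = _
    rw [Matrix.permanent_eq_sum_row _ (Fin.last _)]
    have key : ∀ j : Fin (s + 1 + t + 1),
        (Matrix.of fun i j : Fin (s + 1 + t + 1) => E i.val j.val) (Fin.last _) j *
          ((Matrix.of fun i j : Fin (s + 1 + t + 1) => E i.val j.val).submatrix
            (Fin.last _).succAbove j.succAbove).permanent =
        if s ≤ j.val then ((t + 1).factorial : R) *
          (Matrix.of fun i j : Fin (s + 1) => E i.val j.val).permanent else 0 := by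
      intro j
      rw [Matrix.of_apply, Fin.val_last, hrow _ _ (by omega)]
      split_ifs with hj
      · rw [one_mul, Fin.succAbove_last, submatrix_succAbove_eq_of_colConst s _ E hcol j hj, ih]
      · rw [zero_mul]
    rw [Finset.sum_congr rfl fun j _ => key j,
      Fin.sum_univ_eq_sum_range (fun b => if s ≤ b then ((t + 1).factorial : R) *
        (Matrix.of fun i j : Fin (s + 1) => E i.val j.val).permanent else 0),
      sum_range_ite_le_const, show s + 1 + t + 1 - s = t + 1 + 1 by omega, nsmul_eq_mul,
      ← mul_assoc, Nat.factorial_succ (t + 1)]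
    push_cast
    ring

end Permanent

/-! ### §2 `(t+1)! · per_{s+1}` is a projection of `P (s+1+t) (s+1)` -/

/-- **The substitution.** With `U = [Y; e_s; …; e_s]` and `V_j = e_{min (j, s)}` (variables and
the constants `0, 1` only), `per_{s+1+t} (U Vᵀ) = (t+1)! · per_{s+1} (Y)`; hence
`C (t+1)! * perPoly (Fin (s+1)) ℂ` is a Valiant projection of the rank-`(s+1)` permanent
`P (s+1+t) (s+1)` (Bürgisser 2000, Def. 2.6(1)). [folklore] -/
theorem isProjection_C_mul_perPoly_rankPer (s t : ℕ) :
    IsProjection (C ((t + 1).factorial : ℂ) * perPoly (Fin (s + 1)) ℂ)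
      (aeval (fun x : Fin (s + 1 + t) × Fin (s + 1 + t) => ∑ a : Fin (s + 1),
        (X (Sum.inl (x.1, a)) * X (Sum.inr (x.2, a)) :
          MvPolynomial ((Fin (s + 1 + t) × Fin (s + 1)) ⊕ (Fin (s + 1 + t) × Fin (s + 1))) ℂ))
        (perPoly (Fin (s + 1 + t)) ℂ)) := by
  -- the entries of `U Vᵀ` after substitution, as a function of the natural-number indices
  obtain ⟨E, hE⟩ : ∃ E : ℕ → ℕ → MvPolynomial (Fin (s + 1) × Fin (s + 1)) ℂ, ∀ a b,
      E a b = if ha : a < s + 1 then X (⟨a, ha⟩, ⟨min b s, Nat.lt_succ_of_le (min_le_right b s)⟩)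
      else if s ≤ b then 1 else 0 := ⟨_, fun _ _ => rfl⟩
  have hcol : ∀ a b, s ≤ b → E a b = E a s := fun a b hb => by
    simp only [hE, min_eq_right hb, min_self, hb, le_refl]
  have hrow : ∀ a b, s + 1 ≤ a → E a b = if s ≤ b then 1 else 0 := fun a b ha => by
    simp only [hE, dif_neg (not_lt.mpr ha)]
  have hY : (Matrix.of fun i j : Fin (s + 1) => E i.val j.val) =
      Matrix.mvPolynomialX (Fin (s + 1)) (Fin (s + 1)) ℂ := by
    ext i j
    simp only [Matrix.of_apply, Matrix.mvPolynomialX_apply, hE, dif_pos i.isLt, Fin.eta]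
    congr
    exact min_eq_left (Nat.lt_succ_iff.mp j.isLt)
  refine ⟨Sum.elim
      (fun ib => if hi : ib.1.val < s + 1 then X (⟨ib.1.val, hi⟩, ib.2)
        else if s ≤ ib.2.val then 1 else 0)
      (fun jb => if jb.2.val = min jb.1.val s then 1 else 0), ?_, ?_⟩
  · rintro (⟨i, b⟩ | ⟨j, b⟩)
    · simp only [Sum.elim_inl]
      by_cases hi : i.val < s + 1
      · exact Or.inl ⟨(⟨i.val, hi⟩, b), by rw [dif_pos hi]⟩
      · by_cases hb : s ≤ b.val
        · exact Or.inr ⟨1, by rw [dif_neg hi, if_pos hb, C_1]⟩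
        · exact Or.inr ⟨0, by rw [dif_neg hi, if_neg hb, C_0]⟩
    · simp only [Sum.elim_inr]
      by_cases hb : b.val = min j.val s
      · exact Or.inr ⟨1, by rw [if_pos hb, C_1]⟩
      · exact Or.inr ⟨0, by rw [if_neg hb, C_0]⟩
  · symm
    rw [comp_aeval_apply]
    have hper : ∀ g : Fin (s + 1 + t) × Fin (s + 1 + t) →
        MvPolynomial (Fin (s + 1) × Fin (s + 1)) ℂ, aeval g (perPoly (Fin (s + 1 + t)) ℂ) =
          (Matrix.of fun i j : Fin (s + 1 + t) => g (i, j)).permanent := fun g => by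
      simp [perPoly, Matrix.permanent, map_sum, map_prod]
    rw [hper]
    have hM : (Matrix.of fun i j : Fin (s + 1 + t) => aeval (Sum.elim
        (fun ib : Fin (s + 1 + t) × Fin (s + 1) => if hi : ib.1.val < s + 1 then
          (X (⟨ib.1.val, hi⟩, ib.2) : MvPolynomial (Fin (s + 1) × Fin (s + 1)) ℂ)
          else if s ≤ ib.2.val then 1 else 0)
        (fun jb : Fin (s + 1 + t) × Fin (s + 1) => if jb.2.val = min jb.1.val s then 1 else 0))
        (∑ a : Fin (s + 1), (X (Sum.inl ((i, j).1, a)) * X (Sum.inr ((i, j).2, a)) :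
          MvPolynomial ((Fin (s + 1 + t) × Fin (s + 1)) ⊕ (Fin (s + 1 + t) × Fin (s + 1)))
            ℂ))) =
        Matrix.of fun i j : Fin (s + 1 + t) => E i.val j.val := by
      ext i j
      simp only [Matrix.of_apply, map_sum, map_mul, aeval_X, Sum.elim_inl, Sum.elim_inr]
      rw [Finset.sum_eq_single
        (⟨min j.val s, Nat.lt_succ_of_le (min_le_right _ _)⟩ : Fin (s + 1))]
      · rw [if_pos rfl, mul_one, hE]
        by_cases hi : i.val < s + 1
        · rw [dif_pos hi, dif_pos hi]
        · rw [dif_neg hi, dif_neg hi]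
          simp only [le_min_iff, le_refl, and_true]
      · intro b _ hb
        rw [if_neg (fun h => hb (Fin.ext h)), mul_zero]
      · intro h
        exact absurd (Finset.mem_univ _) h
    rw [hM, permanent_eq_factorial_mul_of_colConst s E hcol hrow t, hY, ← perPoly, map_natCast]

/-! ### §3 Unit scalars and the conclusion -/

/-- For `c ≠ 0`, `dc (per_{m+1}) ≤ dc (c · per_{m+1})`: the attained representation of
`c · per_{m+1}` has positive size (`≥ deg = m + 1`,
`totalDegree_le_determinantalComplexity_holds`, `perPoly_isHomogeneous`, `perPoly_ne_zero`), and
scaling its first row by `c⁻¹` (`hasDetRepr_C_mul`) represents `per_{m+1}` in the same size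
(Mignon–Ressayre 2004, §1).
[folklore] -/
theorem determinantalComplexity_perPoly_le_C_mul_of_ne_zero (m : ℕ) {c : ℂ} (hc : c ≠ 0) :
    determinantalComplexity (perPoly (Fin (m + 1)) ℂ) ≤
      determinantalComplexity (C c * perPoly (Fin (m + 1)) ℂ) := by
  set d := determinantalComplexity (C c * perPoly (Fin (m + 1)) ℂ) with hd
  have hrep : HasDetRepr (C c * perPoly (Fin (m + 1)) ℂ) d :=
    hasDetRepr_determinantalComplexity_holds _
  have hd0 : 0 < d := by
    have hhom : (C c * perPoly (Fin (m + 1)) ℂ).IsHomogeneous (m + 1) := by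
      simpa using (isHomogeneous_C (Fin (m + 1) × Fin (m + 1)) c).mul
        (perPoly_isHomogeneous (n := Fin (m + 1)) (k := ℂ))
    have hne : C c * perPoly (Fin (m + 1)) ℂ ≠ 0 :=
      mul_ne_zero (by rwa [Ne, C_eq_zero]) (perPoly_ne_zero (Fin (m + 1)) ℂ)
    have hdeg := hhom.totalDegree hne
    have hle := totalDegree_le_determinantalComplexity_holds (C c * perPoly (Fin (m + 1)) ℂ)
    omega
  obtain ⟨A, hA, hdet⟩ := hasDetRepr_C_mul c⁻¹ hd0 hrep
  refine determinantalComplexity_le_of_hasDetRepr ⟨A, hA, ?_⟩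
  rw [hdet, ← mul_assoc, ← C_mul, inv_mul_cancel₀ hc, C_1, one_mul]

/-- **S5 — the top pin of the rank ladder: `dc (per_r) ≤ dc (P n r)` for `r ≤ n`.**
For `r = 0`, `dc (per_0) = dc 1 = 0`.  For `r = s + 1` and `n = s + 1 + t`, the substitution
`U = [Y; e_s; …; e_s]`, `V_j = e_{min (j, s)}` (variables and constants) turns
`P n r = per_n (U Vᵀ)` into `(t+1)! · per_r (Y)` (`isProjection_C_mul_perPoly_rankPer`), so
`dc ((t+1)! · per_r) ≤ dc (P n r)` (`determinantalComplexity_le_of_isProjection_holds`,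
Bürgisser 2000, §2.5), and the unit `(t+1)!` of `ℂ` is removed by
`determinantalComplexity_perPoly_le_C_mul_of_ne_zero`. [folklore] -/
theorem stub_perLeRankPer : ∀ r n : ℕ, r ≤ n →
    determinantalComplexity (perPoly (Fin r) ℂ)
    ≤ determinantalComplexity (aeval (fun x : Fin n × Fin n => ∑ a : Fin r,
      (X (Sum.inl (x.1, a)) * X (Sum.inr (x.2, a)) : MvPolynomial ((Fin n × Fin r) ⊕ (Fin n × Fin r)) ℂ))
      (perPoly (Fin n) ℂ)) := by
  intro r n h
  cases r with
  | zero =>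
    rw [Summit.ValiantsHypothesis.Theorems.DetqpThesis.Negative.dcPer_zero]
    exact Nat.zero_le _
  | succ s =>
    obtain ⟨t, rfl⟩ := Nat.exists_eq_add_of_le h
    exact (determinantalComplexity_perPoly_le_C_mul_of_ne_zero s
      (by exact_mod_cast Nat.factorial_ne_zero (t + 1))).trans
      (determinantalComplexity_le_of_isProjection_holds (isProjection_C_mul_perPoly_rankPer s t))

end Summit.ValiantsHypothesis.ValiantsHypothesis.Theorems.DetQPDetqpThesis.ChowRankPerLeRankPer

end
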